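import Summits.QuantumAdvantage.QuantumAdvantage.Theorems.CubicForrelationNearExactIsExactTwelveLevelSixSingleCoset

/-!
# Crux `CubicForrelation.NearExactIsExact` (stmt-QuantumAdvantage-14043) — n = 12, level ≥ 6 AT `Φ = 59/64`: the residual off the 9-flat
  when its energy may reach `128` (closed version of `tw6_off_flat_lt`)

Certificate seat `b2b-cforr-cert` (gen 15).  HONEST FRAMING: a lemma (standard axioms) for the level-`≥ 6` branch of "is `59/64` attained at
`n = 12`?"; finite-slice bookkeeping, NOT summit progress.

`tw15_off_flat_le128`: cubic `f, g`, `W_g = 64u''`, `Z = {u'' even} = x_Z ⊕ V₀` 9-flat, `e = u'' − (−1)^f` with `Σ_{x ∉ Z} e² ≤ 128` (the tree's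
`tw6_off_flat_lt` had `< 128`).  Then EITHER `8 ∣ e` off `Z`, OR the off-flat energy is exactly `128` and the points with `8 ∤ e` lie in two
distinct cosets `y₁ ⊕ V₀`, `y₂ ⊕ V₀` (`≠ Z`), at most `31` in each — the equality configurations "two 16-point sets with `|e| = 2`" (round 1:
a single bad coset is still excluded by the cross-coset localisation `tw6_cross_coset`; three cost `≥ 192`) and "one 8-point set with `|e| = 4`"
(round 2).  The second alternative is what the avoidance localisation `tw15_H34_avoid` consumes.

References: J. Ax (1964) / R. J. McEliece (1972); MacWilliams–Sloane (1977) Ch. 13 §3.  Everything below is proved from Mathlib and the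
tree; axioms are the standard three.
-/

set_option linter.dupNamespace false -- D-0017: single-problem summit ⇒ `QuantumAdvantage.QuantumAdvantage` by design

noncomputable section

namespace Summit.QuantumAdvantage.QuantumAdvantage.Theorems.CubicForrelation.NearExactIsExact

open Finset
open Literature.Computability.QuantumComplexity
open Literature.Computability.QuantumComplexity.BuzetChailloux (bxor zeroVec bxor_bxor_cancel_left bxor_zeroVec zeroVec_bxor bxor_comm
  bxor_self)
open Literature.Computability.QuantumComplexity.DerivativeWalsh (W)

/-! ### The residual off the 9-flat, energy `≤ 128` -/

/-- **Off the flat: `8 ∣ e`, or a sparse two-coset exception at energy exactly `128`.**  Cubic `f, g` on 12 bits with `W_g = 64u''`;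
`Z = {u'' even}` a coset `x_Z ⊕ V₀` of an xor-closed `V₀ ∋ 0` with `2⁹` elements; `e = u'' − (−1)^f` with `Σ_{x ∉ Z} e(x)² ≤ 128`.  Then
`8 ∣ e` off `Z`, or there are `y₁, y₂ ∉ Z` in distinct cosets of `V₀` such that `8 ∣ e` off `Z ∪ (y₁ ⊕ V₀) ∪ (y₂ ⊕ V₀)`, each of the two
cosets has at most `31` points with `8 ∤ e`, and the off-flat energy is exactly `128`. [this work] -/
theorem tw15_off_flat_le128 (f g : (Fin (6 + 6) → Bool) → Bool) (hf : IsDegLeFun 3 f) (hg : IsDegLeFun 3 g)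
    (u'' : (Fin (6 + 6) → Bool) → ℤ) (hu'' : ∀ x, W (fun y => signOf (g y)) x = (2 : ℝ) ^ 6 * (u'' x : ℝ))
    (V₀ : Finset (Fin (6 + 6) → Bool)) (xZ : Fin (6 + 6) → Bool) (h0 : zeroVec ∈ V₀)
    (hadd : ∀ a ∈ V₀, ∀ b ∈ V₀, bxor a b ∈ V₀) (hcardV9 : #V₀ = 2 ^ 9)
    (hS : (univ.filter fun x : Fin (6 + 6) → Bool => ¬ Odd (u'' x)) = V₀.image (bxor xZ))
    (hoff_le : ∑ x ∈ univ.filter (fun x => x ∉ (univ.filter fun x : Fin (6 + 6) → Bool => ¬ Odd (u'' x))),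
      (u'' x - sZ (f x)) ^ 2 ≤ 128) :
    (∀ y, y ∉ (univ.filter fun x : Fin (6 + 6) → Bool => ¬ Odd (u'' x)) → (8 : ℤ) ∣ u'' y - sZ (f y)) ∨
    (∃ y₁ y₂ : Fin (6 + 6) → Bool, y₁ ∉ (univ.filter fun x : Fin (6 + 6) → Bool => ¬ Odd (u'' x)) ∧
      y₂ ∉ (univ.filter fun x : Fin (6 + 6) → Bool => ¬ Odd (u'' x)) ∧ y₂ ∉ V₀.image (bxor y₁) ∧
      (∀ y, y ∉ (univ.filter fun x : Fin (6 + 6) → Bool => ¬ Odd (u'' x)) → y ∉ V₀.image (bxor y₁) → y ∉ V₀.image (bxor y₂) →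
        (8 : ℤ) ∣ u'' y - sZ (f y)) ∧
      #((V₀.image (bxor y₁)).filter fun y => ¬ (8 : ℤ) ∣ u'' y - sZ (f y)) ≤ 31 ∧
      #((V₀.image (bxor y₂)).filter fun y => ¬ (8 : ℤ) ∣ u'' y - sZ (f y)) ≤ 31 ∧
      128 ≤ ∑ x ∈ univ.filter (fun x => x ∉ (univ.filter fun x : Fin (6 + 6) → Bool => ¬ Odd (u'' x))), (u'' x - sZ (f x)) ^ 2) := by
  classical
  set Z := univ.filter (fun x : Fin (6 + 6) → Bool => ¬ Odd (u'' x)) with hZdef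
  have hmemZ : ∀ x, x ∈ Z ↔ ¬ Odd (u'' x) := fun x => by simp [hZdef]
  set u : (Fin (6 + 6) → Bool) → ℤ := fun x => 4 * u'' x with hudef
  have hu : ∀ x, W (fun y => signOf (g y)) x = (2 : ℝ) ^ 4 * (u x : ℝ) := by
    intro x; rw [hu'' x]; simp only [u]; push_cast; ring
  set e : (Fin (6 + 6) → Bool) → ℤ := fun x => u'' x - sZ (f x) with hedef
  show (∀ y, y ∉ Z → (8 : ℤ) ∣ e y) ∨ (∃ y₁ y₂ : Fin (6 + 6) → Bool, y₁ ∉ Z ∧ y₂ ∉ Z ∧ y₂ ∉ V₀.image (bxor y₁) ∧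
      (∀ y, y ∉ Z → y ∉ V₀.image (bxor y₁) → y ∉ V₀.image (bxor y₂) → (8 : ℤ) ∣ e y) ∧
      #((V₀.image (bxor y₁)).filter fun y => ¬ (8 : ℤ) ∣ e y) ≤ 31 ∧ #((V₀.image (bxor y₂)).filter fun y => ¬ (8 : ℤ) ∣ e y) ≤ 31 ∧
      128 ≤ ∑ x ∈ univ.filter (fun x => x ∉ Z), e x ^ 2)
  have hFe : ∀ y, u y - 4 * sZ (f y) = 4 * e y := fun y => by simp only [u, e]; ring
  have heeven : ∀ x, x ∉ Z → Even (e x) := by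
    intro x hx
    have hodd : Odd (u'' x) := not_not.1 fun h => hx ((hmemZ x).2 h)
    rcases tp_sZ_cases (f x) with hs | hs <;> simp only [e] <;> rw [hs]
    · exact Int.even_sub.2 (iff_of_false (Int.not_even_iff_odd.2 hodd) (by decide))
    · exact Int.even_sub.2 (iff_of_false (Int.not_even_iff_odd.2 hodd) (by decide))
  have hPV' : ∀ x, x ∉ Z → ∀ a ∈ V₀, bxor x a ∉ Z := fun x hx a ha => fl1_coset_out' hadd hS hx ha

  -- flat sums of `4e = u − 4s`: `16 ∣` on 6-flats, `32 ∣` on 7-flats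
  have hflat6 : ∀ (b : Fin (6 + 6) → Bool) (a : Fin 6 → Fin (6 + 6) → Bool),
      (4 : ℤ) ∣ ∑ ε : Fin 6 → Bool, e (fun j => b j ^^ decide (Odd #(univ.filter fun i => ε i && a i j))) := by
    intro b a
    have h1 := fs_flat_sum_dvd (e := 4) g u hg hu b a (by norm_num)
    obtain ⟨zf, hzf⟩ := sl_sum_sZ_flat f hf b a
    have hzf' : ∑ ε : Fin 6 → Bool, 4 * sZ (f (fun j => b j ^^ decide (Odd #(univ.filter fun i => ε i && a i j)))) = 16 * zf := by
      rw [← mul_sum, hzf]; norm_num; ring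
    have h1' : (16 : ℤ) ∣ ∑ ε : Fin 6 → Bool, u (fun j => b j ^^ decide (Odd #(univ.filter fun i => ε i && a i j))) := by
      have e16 : (2 : ℤ) ^ 4 = 16 := by norm_num
      rw [e16] at h1; exact h1
    have h2 : (16 : ℤ) ∣ ∑ ε : Fin 6 → Bool, (u (fun j => b j ^^ decide (Odd #(univ.filter fun i => ε i && a i j))) -
        4 * sZ (f (fun j => b j ^^ decide (Odd #(univ.filter fun i => ε i && a i j))))) := by
      rw [sum_sub_distrib, hzf']
      exact dvd_sub h1' (Dvd.intro _ rfl)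
    have h3 : ∑ ε : Fin 6 → Bool, (u (fun j => b j ^^ decide (Odd #(univ.filter fun i => ε i && a i j))) -
        4 * sZ (f (fun j => b j ^^ decide (Odd #(univ.filter fun i => ε i && a i j))))) =
        4 * ∑ ε : Fin 6 → Bool, e (fun j => b j ^^ decide (Odd #(univ.filter fun i => ε i && a i j))) := by
      rw [mul_sum]; exact sum_congr rfl fun ε _ => hFe _
    rw [h3] at h2
    obtain ⟨k, hk⟩ := h2
    exact ⟨k, by linarith⟩
  have hflat7 : ∀ (b : Fin (6 + 6) → Bool) (a : Fin 7 → Fin (6 + 6) → Bool),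
      (8 : ℤ) ∣ ∑ ε : Fin 7 → Bool, e (fun j => b j ^^ decide (Odd #(univ.filter fun i => ε i && a i j))) := by
    intro b a
    have h1 := fs_flat_sum_dvd (e := 5) g u hg hu b a (by norm_num)
    obtain ⟨zf, hzf⟩ := sl_sum_sZ_flat f hf b a
    have hzf' : ∑ ε : Fin 7 → Bool, 4 * sZ (f (fun j => b j ^^ decide (Odd #(univ.filter fun i => ε i && a i j)))) = 32 * zf := by
      rw [← mul_sum, hzf]; norm_num; ring
    have h1' : (32 : ℤ) ∣ ∑ ε : Fin 7 → Bool, u (fun j => b j ^^ decide (Odd #(univ.filter fun i => ε i && a i j))) := by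
      have e32 : (2 : ℤ) ^ 5 = 32 := by norm_num
      rw [e32] at h1; exact h1
    have h2 : (32 : ℤ) ∣ ∑ ε : Fin 7 → Bool, (u (fun j => b j ^^ decide (Odd #(univ.filter fun i => ε i && a i j))) -
        4 * sZ (f (fun j => b j ^^ decide (Odd #(univ.filter fun i => ε i && a i j))))) := by
      rw [sum_sub_distrib, hzf']
      exact dvd_sub h1' (Dvd.intro _ rfl)
    have h3 : ∑ ε : Fin 7 → Bool, (u (fun j => b j ^^ decide (Odd #(univ.filter fun i => ε i && a i j))) -
        4 * sZ (f (fun j => b j ^^ decide (Odd #(univ.filter fun i => ε i && a i j))))) =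
        4 * ∑ ε : Fin 7 → Bool, e (fun j => b j ^^ decide (Odd #(univ.filter fun i => ε i && a i j))) := by
      rw [mul_sum]; exact sum_congr rfl fun ε _ => hFe _
    rw [h3] at h2
    obtain ⟨k, hk⟩ := h2
    exact ⟨k, by linarith⟩
  -- OFF-Z KILL, round 1: `4 ∣ e` off `Z`
  have hcos_out : ∀ p, p ∉ Z → ∀ b ∈ V₀.image (bxor p), b ∉ Z := by
    intro p hp b hb
    obtain ⟨v, hv, rfl⟩ := mem_image.1 hb
    exact hPV' p hp v hv
  have hoff_count : ∀ (T : Finset (Fin (6 + 6) → Bool)) (c : ℤ), (∀ x ∈ T, x ∉ Z) → (∀ x ∈ T, c ≤ e x ^ 2) →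
      c * #T ≤ 128 := by
    intro T c hT hc
    calc c * #T = ∑ x ∈ T, c := by rw [sum_const, nsmul_eq_mul, mul_comm]
      _ ≤ ∑ x ∈ T, e x ^ 2 := sum_le_sum hc
      _ ≤ ∑ x ∈ univ.filter (fun x => x ∉ Z), e x ^ 2 :=
          sum_le_sum_of_subset_of_nonneg (fun x hx => mem_filter.2 ⟨mem_univ _, hT x hx⟩) fun x _ _ => sq_nonneg _
      _ ≤ 128 := hoff_le
  have hxZ : xZ ∈ Z := by rw [hS]; exact mem_image.2 ⟨zeroVec, h0, bxor_zeroVec xZ⟩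
  have hPV : ∀ x, x ∈ Z → ∀ a ∈ V₀, bxor x a ∈ Z := fun x hx a ha => fl1_coset_vadd hadd hS hx ha
  have hp2 : ∀ y, y ∉ Z → e y = 2 * (e y / 2) := fun y hy =>
    (Int.mul_ediv_cancel' (even_iff_two_dvd.1 (heeven y hy))).symm
  have hcost4 : ∀ x, x ∉ Z → Odd (e x / 2) → 4 ≤ e x ^ 2 := by
    intro x hx hodd
    have h0' := Int.odd_iff.1 hodd
    have h2 := hp2 x hx
    have : e x ≤ -2 ∨ 2 ≤ e x := by omega
    have := tp_sq_ge (k := 2) (by norm_num) this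
    linarith
  -- round 1a: in a coset `p ⊕ V₀` (`p ∉ Z`) `e/2` is even, or odd at `≥ 16` points (6-flat parity + Reed–Muller on the abstract flat)
  have hdich : ∀ p, p ∉ Z → (∀ x ∈ V₀.image (bxor p), Even (e x / 2)) ∨
      16 ≤ #((V₀.image (bxor p)).filter fun x => Odd (e x / 2)) := by
    intro p hp
    rcases ws_erm_round V₀ h0 hadd hcardV9 p (fun y => e y / 2) 5 (fun b hb a ha => by
        have hpts : ∀ ε : Fin (5 + 1) → Bool, (fun j => b j ^^ decide (Odd #(univ.filter fun i => ε i && a i j))) ∉ Z :=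
          fun ε => ws_flatPt_mem V₀ h0 (· ∉ Z) hPV' (5 + 1) b (hcos_out p hp b hb) a ha ε
        have h4 := hflat6 b a
        rw [sum_congr rfl fun ε _ => hp2 _ (hpts ε), ← mul_sum] at h4
        obtain ⟨k, hk⟩ := h4
        exact ⟨k, by linarith⟩) with hev | hbig
    · exact Or.inl hev
    · right; norm_num at hbig; omega
  have hbad_of_odd : ∀ p, p ∉ Z → Odd (e p / 2) → 16 ≤ #((V₀.image (bxor p)).filter fun x => Odd (e x / 2)) := by
    intro p hp hpodd
    refine (hdich p hp).resolve_left fun h => ?_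
    exact (Int.not_even_iff_odd.2 hpodd) (h p (mem_image.2 ⟨zeroVec, h0, bxor_zeroVec p⟩))
  -- a nonzero even value costs `≥ 4`
  have hcost4' : ∀ x, x ∉ Z → e x ≠ 0 → 4 ≤ e x ^ 2 := by
    intro x hx hne
    obtain ⟨k, hk⟩ := heeven x hx
    have hk0 : k ≠ 0 := by rintro rfl; exact hne (by rw [hk]; ring)
    have : e x ≤ -2 ∨ 2 ≤ e x := by omega
    have := tp_sq_ge (k := 2) (by norm_num) this
    linarith
  have hsymm : ∀ q x : Fin (6 + 6) → Bool, x ∈ V₀.image (bxor q) → q ∈ V₀.image (bxor x) := by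
    intro q x hx
    obtain ⟨v, hv, hvx⟩ := mem_image.1 hx
    refine mem_image.2 ⟨v, hv, ?_⟩
    rw [← hvx, iw_bxor_assoc, bxor_self, bxor_zeroVec]
  have hchain : ∀ q x w : Fin (6 + 6) → Bool, x ∈ V₀.image (bxor q) → w ∈ V₀.image (bxor x) → w ∈ V₀.image (bxor q) := by
    intro q x w hx hw
    obtain ⟨v, hv, hvx⟩ := mem_image.1 hx
    obtain ⟨v', hv', hv'w⟩ := mem_image.1 hw
    refine mem_image.2 ⟨bxor v v', hadd v hv v' hv', ?_⟩
    rw [← hv'w, ← hvx, iw_bxor_assoc]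
  by_cases hBad : ∃ p, p ∉ Z ∧ Odd (e p / 2)
  · obtain ⟨p, hp, hpodd⟩ := hBad
    have hbad := hbad_of_odd p hp hpodd
    by_cases htwo : ∃ z, z ∉ Z ∧ z ∉ V₀.image (bxor p) ∧ Odd (e z / 2)
    · /- TWO bad cosets: the sparse exception -/
      obtain ⟨z, hz, hzC, hzodd⟩ := htwo
      have hCz := hbad_of_odd z hz hzodd
      have hpCz : p ∉ V₀.image (bxor z) := fun h => hzC (hsymm z p h)
      -- capacity: a coset off `Z` disjoint from a bad coset has at most `16` non-multiples of `8`
      have hcap : ∀ q q' : Fin (6 + 6) → Bool, q ∉ Z → q' ∉ Z → q' ∉ V₀.image (bxor q) →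
          16 ≤ #((V₀.image (bxor q')).filter fun x => Odd (e x / 2)) →
          #((V₀.image (bxor q)).filter fun y => ¬ (8 : ℤ) ∣ e y) ≤ 31 := by
        intro q q' hq hq' hq'C h16
        set A := (V₀.image (bxor q)).filter (fun y => ¬ (8 : ℤ) ∣ e y) with hA
        set B := (V₀.image (bxor q')).filter (fun x => Odd (e x / 2)) with hB
        have hdisjAB : Disjoint A B := by
          rw [disjoint_left]
          intro x hxA hxB
          exact hq'C (hchain q x q' (mem_filter.1 hxA).1 (hsymm q' x (mem_filter.1 hxB).1))
        have hsubAB : A ∪ B ⊆ univ.filter (fun x => x ∉ Z) := by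
          intro x hx
          rcases mem_union.1 hx with h | h
          · exact mem_filter.2 ⟨mem_univ _, hcos_out q hq x (mem_filter.1 h).1⟩
          · exact mem_filter.2 ⟨mem_univ _, hcos_out q' hq' x (mem_filter.1 h).1⟩
        have h1 : ∑ x ∈ A ∪ B, (4 : ℤ) ≤ ∑ x ∈ A ∪ B, e x ^ 2 := sum_le_sum fun x hx => by
          rcases mem_union.1 hx with h | h
          · exact hcost4' x (hcos_out q hq x (mem_filter.1 h).1) (fun h0 => (mem_filter.1 h).2 (by rw [h0]; exact dvd_zero _))
          · exact hcost4 x (hcos_out q' hq' x (mem_filter.1 h).1) (mem_filter.1 h).2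
        have h2 := sum_le_sum_of_subset_of_nonneg hsubAB (f := fun x => e x ^ 2) fun x _ _ => sq_nonneg _
        rw [sum_const, nsmul_eq_mul, card_union_of_disjoint hdisjAB] at h1
        push_cast at h1
        have h16' : (16 : ℤ) ≤ #B := by exact_mod_cast h16
        have hA16 : (#A : ℤ) ≤ 16 := by linarith
        have : #A ≤ 16 := by exact_mod_cast hA16
        omega
      set Bp := (V₀.image (bxor p)).filter (fun x => Odd (e x / 2)) with hBp
      set Bz := (V₀.image (bxor z)).filter (fun x => Odd (e x / 2)) with hBz
      have hdisj : Disjoint Bp Bz := by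
        rw [disjoint_left]
        intro x hxp hxz
        exact hzC (hchain p x z (mem_filter.1 hxp).1 (hsymm z x (mem_filter.1 hxz).1))
      -- energy: the two bad sets already cost `128`
      have hBsum : (128 : ℤ) ≤ ∑ x ∈ Bp ∪ Bz, e x ^ 2 := by
        have h1 : ∑ x ∈ Bp ∪ Bz, (4 : ℤ) ≤ ∑ x ∈ Bp ∪ Bz, e x ^ 2 := sum_le_sum fun x hx => by
          rcases mem_union.1 hx with h | h
          · exact hcost4 x (hcos_out p hp x (mem_filter.1 h).1) (mem_filter.1 h).2
          · exact hcost4 x (hcos_out z hz x (mem_filter.1 h).1) (mem_filter.1 h).2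
        rw [sum_const, nsmul_eq_mul, card_union_of_disjoint hdisj] at h1
        push_cast at h1
        have h16p : (16 : ℤ) ≤ #Bp := by exact_mod_cast hbad
        have h16z : (16 : ℤ) ≤ #Bz := by exact_mod_cast hCz
        linarith
      have hBsub : Bp ∪ Bz ⊆ univ.filter (fun x => x ∉ Z) := by
        intro x hx
        rcases mem_union.1 hx with h | h
        · exact mem_filter.2 ⟨mem_univ _, hcos_out p hp x (mem_filter.1 h).1⟩
        · exact mem_filter.2 ⟨mem_univ _, hcos_out z hz x (mem_filter.1 h).1⟩
      have hBle : ∑ x ∈ Bp ∪ Bz, e x ^ 2 ≤ ∑ x ∈ univ.filter (fun x => x ∉ Z), e x ^ 2 :=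
        sum_le_sum_of_subset_of_nonneg hBsub fun x _ _ => sq_nonneg _
      -- every other point off `Z` has `e = 0`
      have hzero : ∀ y, y ∉ Z → y ∉ Bp ∪ Bz → e y = 0 := by
        intro y hy hyB
        by_contra hne
        have hins : insert y (Bp ∪ Bz) ⊆ univ.filter (fun x => x ∉ Z) := by
          intro x hx
          rcases mem_insert.1 hx with rfl | hx
          · exact mem_filter.2 ⟨mem_univ _, hy⟩
          · exact hBsub hx
        have h := sum_le_sum_of_subset_of_nonneg hins (f := fun x => e x ^ 2) fun x _ _ => sq_nonneg _
        rw [sum_insert hyB] at h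
        have := hcost4' y hy hne
        linarith
      right
      refine ⟨p, z, hp, hz, hzC, ?_, hcap p z hp hz hzC hCz, hcap z p hz hp hpCz hbad, le_trans hBsum hBle⟩
      intro y hy hyp hyz
      have : e y = 0 := hzero y hy (fun h => by
        rcases mem_union.1 h with h | h
        · exact hyp (mem_filter.1 h).1
        · exact hyz (mem_filter.1 h).1)
      rw [this]; exact dvd_zero _
    · /- ONE bad coset: excluded by the cross-coset localisation (`tw15_single_bad_coset_false`) -/
      push Not at htwo
      exact (tw15_single_bad_coset_false f g hf hg u'' hu'' V₀ xZ h0 hadd hcardV9 hS hoff_le p hp hpodd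
        (fun z hz hzC => Int.not_odd_iff_even.1 (htwo z hz hzC))).elim
  · /- no point with `e/2` odd: `4 ∣ e` off `Z`; round 2 -/
    push Not at hBad
    have hdiv4 : ∀ y, y ∉ Z → (4 : ℤ) ∣ e y := by
      intro y hy
      have hev : Even (e y / 2) := Int.not_odd_iff_even.1 (hBad y hy)
      obtain ⟨k, hk⟩ := hev
      exact ⟨k, by rw [hp2 y hy, hk]; ring⟩
    have hp4 : ∀ y, y ∉ Z → e y = 4 * (e y / 4) := fun y hy => (Int.mul_ediv_cancel' (hdiv4 y hy)).symm
    have hcost16 : ∀ x, x ∉ Z → Odd (e x / 4) → 16 ≤ e x ^ 2 := by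
      intro x hxZ hodd
      have h0' := Int.odd_iff.1 hodd
      have h2 := hp4 x hxZ
      have : e x ≤ -4 ∨ 4 ≤ e x := by omega
      have := tp_sq_ge (k := 4) (by norm_num) this
      linarith
    have hdich4 : ∀ p, p ∉ Z → (∀ x ∈ V₀.image (bxor p), Even (e x / 4)) ∨
        8 ≤ #((V₀.image (bxor p)).filter fun x => Odd (e x / 4)) := by
      intro p hp
      rcases ws_erm_round V₀ h0 hadd hcardV9 p (fun y => e y / 4) 6 (fun b hb a ha => by
          have hpts : ∀ ε : Fin (6 + 1) → Bool, (fun j => b j ^^ decide (Odd #(univ.filter fun i => ε i && a i j))) ∉ Z :=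
            fun ε => ws_flatPt_mem V₀ h0 (· ∉ Z) hPV' (6 + 1) b (hcos_out p hp b hb) a ha ε
          have h8 := hflat7 b a
          rw [sum_congr rfl fun ε _ => hp4 _ (hpts ε), ← mul_sum] at h8
          obtain ⟨k, hk⟩ := h8
          exact ⟨k, by linarith⟩) with hev | hbig
      · exact Or.inl hev
      · right; norm_num at hbig; omega
    by_cases hBad4 : ∃ p, p ∉ Z ∧ Odd (e p / 4)
    · obtain ⟨p, hp, hpodd⟩ := hBad4
      set B4 := (V₀.image (bxor p)).filter (fun x => Odd (e x / 4)) with hB4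
      have hB4ge : 8 ≤ #B4 := (hdich4 p hp).resolve_left fun h =>
        (Int.not_even_iff_odd.2 hpodd) (h p (mem_image.2 ⟨zeroVec, h0, bxor_zeroVec p⟩))
      have hB4sub : B4 ⊆ univ.filter (fun x => x ∉ Z) := fun x hx =>
        mem_filter.2 ⟨mem_univ _, hcos_out p hp x (mem_filter.1 hx).1⟩
      have hB4sum : (128 : ℤ) ≤ ∑ x ∈ B4, e x ^ 2 := by
        have h1 : ∑ x ∈ B4, (16 : ℤ) ≤ ∑ x ∈ B4, e x ^ 2 := sum_le_sum fun x hx =>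
          hcost16 x (hcos_out p hp x (mem_filter.1 hx).1) (mem_filter.1 hx).2
        rw [sum_const, nsmul_eq_mul] at h1
        have h8 : (8 : ℤ) ≤ #B4 := by exact_mod_cast hB4ge
        linarith
      have hB4le : ∑ x ∈ B4, e x ^ 2 ≤ ∑ x ∈ univ.filter (fun x => x ∉ Z), e x ^ 2 :=
        sum_le_sum_of_subset_of_nonneg hB4sub fun x _ _ => sq_nonneg _
      have hzero : ∀ y, y ∉ Z → y ∉ B4 → e y = 0 := by
        intro y hy hyB
        by_contra hne
        have hins : insert y B4 ⊆ univ.filter (fun x => x ∉ Z) := by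
          intro x hx
          rcases mem_insert.1 hx with rfl | hx
          · exact mem_filter.2 ⟨mem_univ _, hy⟩
          · exact hB4sub hx
        have h := sum_le_sum_of_subset_of_nonneg hins (f := fun x => e x ^ 2) fun x _ _ => sq_nonneg _
        rw [sum_insert hyB] at h
        have := hcost4' y hy hne
        linarith
      -- a second, empty coset off `Z` and off `p ⊕ V₀`
      obtain ⟨d, -, hd⟩ := fl1_avoid univ V₀ [xZ, p] (by
        rw [hcardV9, card_univ, Fintype.card_fun, Fintype.card_bool, Fintype.card_fin]; norm_num)
      have hdZ : d ∉ Z := by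
        intro h
        rw [hS] at h
        obtain ⟨v, hv, hvd⟩ := mem_image.1 h
        exact hd xZ (by simp) (by rw [← hvd, bxor_bxor_cancel_left]; exact hv)
      have hdC : d ∉ V₀.image (bxor p) := by
        intro h
        obtain ⟨v, hv, hvd⟩ := mem_image.1 h
        exact hd p (by simp) (by rw [← hvd, bxor_bxor_cancel_left]; exact hv)
      right
      refine ⟨p, d, hp, hdZ, hdC, ?_, ?_, ?_, le_trans hB4sum hB4le⟩
      · intro y hy hyp _
        have : e y = 0 := hzero y hy (fun h => hyp (mem_filter.1 h).1)
        rw [this]; exact dvd_zero _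
      · have hsub : ((V₀.image (bxor p)).filter fun y => ¬ (8 : ℤ) ∣ e y) ⊆ B4 := by
          intro y hy
          have hy1 := (mem_filter.1 hy).1
          have hy2 := (mem_filter.1 hy).2
          refine mem_filter.2 ⟨hy1, ?_⟩
          by_contra hev
          have hyZ : y ∉ Z := hcos_out p hp y hy1
          have hyB : y ∉ B4 := fun h => hev (mem_filter.1 h).2
          exact hy2 (by rw [hzero y hyZ hyB]; exact dvd_zero _)
        have h1 := card_le_card hsub
        have h2 : (#B4 : ℤ) * 16 ≤ 128 := by
          have h := sum_le_sum fun x (hx : x ∈ B4) => hcost16 x (hcos_out p hp x (mem_filter.1 hx).1) (mem_filter.1 hx).2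
          rw [sum_const, nsmul_eq_mul] at h
          linarith
        have : #B4 ≤ 8 := by
          have : (#B4 : ℤ) ≤ 8 := by linarith
          exact_mod_cast this
        omega
      · have hsub : ((V₀.image (bxor d)).filter fun y => ¬ (8 : ℤ) ∣ e y) = ∅ := by
          refine filter_eq_empty_iff.2 fun y hy h8 => h8 ?_
          have hyZ : y ∉ Z := hcos_out d hdZ y hy
          have hyB : y ∉ B4 := fun h => hdC (hchain p y d (mem_filter.1 h).1 (hsymm d y hy))
          rw [hzero y hyZ hyB]; exact dvd_zero _
        rw [hsub, card_empty]; norm_num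
    · push Not at hBad4
      left
      intro y hy
      have hev : Even (e y / 4) := Int.not_odd_iff_even.1 (hBad4 y hy)
      obtain ⟨k, hk⟩ := hev
      exact ⟨k, by rw [hp4 y hy, hk]; ring⟩

end Summit.QuantumAdvantage.QuantumAdvantage.Theorems.CubicForrelation.NearExactIsExact

end
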